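import Literature.Analysis.FluidPDE.ClassicalSolution
import Literature.Analysis.FluidPDE.WholeSpaceIBP
import Mathlib.Analysis.Calculus.DerivativeTest
import HarnessLib

/-!
# The weak maximum principle for drift–diffusion systems on the whole space

Analysis/FluidPDE proofs file (theorems only, no definitions, no named facts). For a field
`v : [0,T] × E → F` (`E` a finite-dimensional real inner-product space, `F` a real inner-product
space), jointly `C^∞` on the closed slab (tree `IsSmoothSpaceTimeOn (Icc 0 T) v`), solving the
drift–diffusion system

  `∂ₜv = κ Δv − (u·∇)v`  on `[0,T] × E`,  `κ ≥ 0`,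

pointwise with the tree's one-sided time derivative `timeDerivWithin (Icc 0 T)`, Mathlib's Laplacian
`Δ` and the tree's convective derivative `convect (u t) (v t) x = Dv(t,x)[u(t,x)]`, for an ARBITRARY
drift `u : [0,T] × E → E` (no regularity, size or divergence condition), and decaying at spatial
infinity UNIFORMLY in `t ∈ [0,T]` (`|v(t,x)| → 0` as `|x| → ∞` uniformly in `t`, the hypothesis
"`lim inf_{|x|→∞} u(x,t) ≥ 0` uniformly with respect to `t`" of Friedman's Lemma 5), every bound of
`|v(0,·)|` bounds `|v|` on the slab:

* `norm_le_of_inner_timeDeriv_le` — the SUBSOLUTION form: it suffices that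
  `⟪v, ∂ₜv⟫ ≤ ⟪v, κΔv − (u·∇)v⟫` pointwise (so absorption / reaction terms `g` with `⟪v, g⟫ ≤ 0` are
  allowed); conclusion `(∀ x, |v(0,x)| ≤ M) → ∀ t ∈ [0,T], ∀ x, |v(t,x)| ≤ M`;
* `norm_le_of_driftDiffusion`, `norm_le_of_driftDiffusion'` — the equation `∂ₜv = κΔv − (u·∇)v`,
  in the two shapes `∂ₜv = …` and `∂ₜv − κΔv + (u·∇)v = 0`.

This is Friedman, *Partial Differential Equations of Parabolic Type* (1964), Ch. 2 §4, Lemma 5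
(weak maximum principle for the Cauchy problem under decay uniform in `t`), in the case `a = κI`,
`c = 0`, applied to the scalar subsolution `e^{−2εt}|v|²` of a system — the device of, e.g., the
sup-norm estimate (4.59)–(4.65) in G. Liu, arXiv:2507.18063, p. 28, where this file's proof was first
run in the tree (`Literature.Claims.NS.Liu2025.driftHeatMaxPrinciple'_holds`). Proof: for `ε > 0`
the function `ψ = e^{−2εt}|v|²` attains its maximum over the slab (uniform decay + compactness of
`[0,T] × B̄_R`); if that maximum exceeded `M²` it would sit at a point `(t₀,x₀)` with `t₀ > 0`, where
one-sided Fermat in `t` gives `∂ₜψ ≥ 0`, i.e. `⟪v, ∂ₜv⟫ ≥ ε|v|² > 0`, while the spatial first- and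
second-order conditions give `⟪v, Dv[w]⟫ = ½ D|v|²[w] = 0` for every `w` (so the drift term drops
out whatever `u` is) and `⟪v, Δv⟫ ≤ 0` (directional second-derivative test summed over an
orthonormal frame), so that the equation forces `⟪v, ∂ₜv⟫ = κ⟪v, Δv⟫ ≤ 0`; hence `ψ ≤ M²` for every
`ε > 0`, and `ε ↓ 0`. The uniformity of the decay cannot be dropped (a bump translating in from
spatial infinity as `t ↓ 0` is a smooth solution, for a suitable unbounded drift, with `v(0) = 0`).

Tree neighbours (not imported): the torus versions `Torus.IsClassicalScalarTransportOn.le_of_le`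
(`ScalarTransportMaxPrinciple`), `…abs_le_of_forall_abs_init_le` (`PassiveScalarMaximumPrinciple`);
the bounded-domain scalar versions `SwirlMaximumPrinciple.weak_max_principle`,
`ParabolicComparison.paraboloid_comparison`; the second-order condition `IsLocalMax.laplacian_nonpos`
(`ParabolicComparison`, scalar; re-derived here for `|V|²` of a vector field along lines).

## References

* A. Friedman, *Partial Differential Equations of Parabolic Type*, Prentice–Hall (1964) (Dover
  reprint 2008), Ch. 2 §4, Lemma 5; §3, remark (b) (the factor `e^{εt}`). [Friedman1964]
* G. M. Lieberman, *Second Order Parabolic Differential Equations*, World Scientific (1996), Ch. II,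
  Lemma 2.1, Lemma 2.3. [Lieberman1996]
-/

noncomputable section

open Set Function Filter Metric
open scoped RealInnerProductSpace Laplacian ContDiff Topology

namespace Literature.Analysis.FluidPDE

variable {E : Type*} [NormedAddCommGroup E] [InnerProductSpace ℝ E] [FiniteDimensional ℝ E]
variable {F : Type*} [NormedAddCommGroup F] [InnerProductSpace ℝ F]

/-! ### First- and second-order conditions at a global maximum of `|V|²` -/

section MaxPoint

omit [FiniteDimensional ℝ E] in
/-- First-order condition at a global maximum `x₀` of `|V|²`: `⟪V(x₀), DV(x₀) w⟫ = 0` for every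
direction `w` (`D|V|² = 0`). [cite: Lieberman1996, Ch. II Lemma 2.1 (proof, "Dv(X) = 0")] -/
theorem inner_fderiv_eq_zero_of_forall_norm_sq_le {V : E → F} (hV : ContDiff ℝ ∞ V) {x₀ : E}
    (hmax : ∀ x, ‖V x‖ ^ 2 ≤ ‖V x₀‖ ^ 2) (w : E) : ⟪V x₀, fderiv ℝ V x₀ w⟫ = 0 := by
  have hloc : IsLocalMax (fun x => ‖V x‖ ^ 2) x₀ := Filter.Eventually.of_forall hmax
  have hd := (hV.differentiable (by simp) x₀).hasFDerivAt.norm_sq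
  have h0 := hloc.hasFDerivAt_eq_zero hd
  have h1 := congrArg (fun L : E →L[ℝ] ℝ => L w) h0
  simpa using h1

omit [FiniteDimensional ℝ E] in
/-- Second-order condition at a global maximum `x₀` of `|V|²` along a direction `e`:
`⟪V(x₀), ∂ₑ∂ₑV(x₀)⟫ ≤ 0` (from `∂ₑ∂ₑ|V|² = 2|∂ₑV|² + 2⟪V, ∂ₑ∂ₑV⟫ ≤ 0` on the line `x₀ + ℝe`).
[cite: Lieberman1996, Ch. II Lemma 2.1 (proof, "D²v(X) is nonpositive")] -/
theorem inner_fderiv_fderiv_nonpos_of_forall_norm_sq_le {V : E → F} (hV : ContDiff ℝ ∞ V) {x₀ : E}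
    (hmax : ∀ x, ‖V x‖ ^ 2 ≤ ‖V x₀‖ ^ 2) (e : E) :
    ⟪V x₀, fderiv ℝ (fun y => fderiv ℝ V y e) x₀ e⟫ ≤ 0 := by
  have hV2 : ContDiff ℝ 2 V := contDiff_infty.mp hV 2
  -- `W = ∂ₑ V`
  set W : E → F := fun y => fderiv ℝ V y e with hW
  have hVd : ∀ y, HasFDerivAt V (fderiv ℝ V y) y := fun y =>
    (hV2.differentiable (by simp) y).hasFDerivAt
  have hW1 : ContDiff ℝ 1 W := (hV2.fderiv_right (m := 1) le_rfl).clm_apply contDiff_const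
  have hWd : ∀ y, HasFDerivAt W (fderiv ℝ W y) y := fun y =>
    (hW1.differentiable one_ne_zero y).hasFDerivAt
  -- the line `p s = x₀ + s e`
  let p : ℝ → E := fun s => x₀ + s • e
  have hp0 : p 0 = x₀ := by simp [p]
  have hpd : ∀ s, HasDerivAt p e s := fun s => by
    show HasDerivAt (fun s : ℝ => x₀ + s • e) e s
    simpa using ((hasDerivAt_id s).smul_const e).const_add x₀
  have hVp : ∀ s, HasDerivAt (fun s => V (p s)) (W (p s)) s := fun s => by
    have := (hVd (p s)).comp_hasDerivAt s (hpd s)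
    simpa [hW, Function.comp_def] using this
  have hWp : ∀ s, HasDerivAt (fun s => W (p s)) (fderiv ℝ W (p s) e) s := fun s => by
    have := (hWd (p s)).comp_hasDerivAt s (hpd s)
    simpa [Function.comp_def] using this
  -- `ℓ(s) = |V(p s)|²` and its first two derivatives
  set ℓ : ℝ → ℝ := fun s => ⟪V (p s), V (p s)⟫ with hℓ
  have hℓd : ∀ s, HasDerivAt ℓ (2 * ⟪V (p s), W (p s)⟫) s := fun s => by
    refine ((hVp s).inner ℝ (hVp s)).congr_deriv ?_
    rw [real_inner_comm (W (p s)), two_mul]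
  have hderiv : deriv ℓ = fun s => 2 * ⟪V (p s), W (p s)⟫ := funext fun s => (hℓd s).deriv
  have hℓdd : ∀ s, HasDerivAt (fun s => 2 * ⟪V (p s), W (p s)⟫)
      (2 * (⟪V (p s), fderiv ℝ W (p s) e⟫ + ⟪W (p s), W (p s)⟫)) s := fun s =>
    ((hVp s).inner ℝ (hWp s)).const_mul 2
  have hderiv2 : deriv (deriv ℓ) 0 = 2 * (⟪V x₀, fderiv ℝ W x₀ e⟫ + ⟪W x₀, W x₀⟫) := by
    rw [hderiv, (hℓdd 0).deriv, hp0]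
  have hderiv1 : deriv ℓ 0 = 0 := by
    rw [hderiv]
    simp only [hp0, hW]
    rw [inner_fderiv_eq_zero_of_forall_norm_sq_le hV hmax e, mul_zero]
  -- `ℓ` has a (global, hence local) maximum at `0`
  have hℓmax : IsLocalMax ℓ 0 := Filter.Eventually.of_forall fun s => by
    simp only [hℓ, real_inner_self_eq_norm_sq, hp0]
    exact hmax _
  -- if the second derivative were positive, `0` would also be a local minimum, so `ℓ` would be
  -- locally constant and its second derivative would vanish
  by_contra hcon
  push Not at hcon
  have hpos : deriv (deriv ℓ) 0 > 0 := by
    rw [hderiv2]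
    have : 0 ≤ ⟪W x₀, W x₀⟫ := real_inner_self_nonneg
    linarith
  have hℓmin : IsLocalMin ℓ 0 := isLocalMin_of_deriv_deriv_pos hpos hderiv1 (hℓd 0).continuousAt
  have hconst : ∀ᶠ s in 𝓝 (0 : ℝ), ℓ s = ℓ 0 :=
    (hℓmin.and hℓmax).mono fun s hs => le_antisymm hs.2 hs.1
  have hd0 : deriv ℓ =ᶠ[𝓝 (0 : ℝ)] fun _ => (0 : ℝ) := by
    filter_upwards [hconst.eventually_nhds] with s hs
    have h1 : ℓ =ᶠ[𝓝 s] fun _ => ℓ 0 := hs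
    rw [h1.deriv_eq, deriv_const]
  have : deriv (deriv ℓ) 0 = 0 := by rw [hd0.deriv_eq, deriv_const]
  linarith

/-- At a global maximum `x₀` of `|V|²`: `⟪V(x₀), ΔV(x₀)⟫ ≤ 0` (the directional second-order
conditions summed over an orthonormal frame, `ΔV = Σᵢ ∂ᵢ∂ᵢV`). [cite: Lieberman1996, Ch. II Lemma 2.1 (proof, "D²v(X) is nonpositive")] -/
theorem inner_laplacian_nonpos_of_forall_norm_sq_le {V : E → F} (hV : ContDiff ℝ ∞ V) {x₀ : E}
    (hmax : ∀ x, ‖V x‖ ^ 2 ≤ ‖V x₀‖ ^ 2) : ⟪V x₀, (Δ V) x₀⟫ ≤ 0 := by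
  have hV2 : ContDiff ℝ 2 V := contDiff_infty.mp hV 2
  rw [laplacian_eq_sum_fderiv_fderiv (stdOrthonormalBasis ℝ E) hV2 x₀, inner_sum]
  exact Finset.sum_nonpos fun i _ => inner_fderiv_fderiv_nonpos_of_forall_norm_sq_le hV hmax _

/-- One-sided Fermat at a maximum over `[0,T]` attained at `t₀ > 0`: the derivative within `[0,T]`
is `≥ 0` ("`v_t(X) ≥ 0`"). [cite: Lieberman1996, Ch. II Lemma 2.1 (proof, "v_t(X) ≥ 0")] -/
theorem derivWithin_Icc_nonneg_of_forall_le {k : ℝ → ℝ} {k' T t₀ : ℝ} (ht₀ : t₀ ∈ Icc 0 T)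
    (ht₀' : 0 < t₀) (hk : HasDerivWithinAt k k' (Icc 0 T) t₀) (hmax : ∀ s ∈ Icc 0 T, k s ≤ k t₀) :
    0 ≤ k' := by
  have hloc : IsLocalMaxOn k (Icc 0 T) t₀ := (isMaxOn_iff.mpr hmax).localize
  have hseg : segment ℝ t₀ (t₀ + -t₀) ⊆ Icc 0 T := by
    rw [add_neg_cancel, segment_symm, segment_eq_Icc ht₀'.le]
    exact Icc_subset_Icc le_rfl ht₀.2
  have hy : -t₀ ∈ posTangentConeAt (Icc 0 T) t₀ := mem_posTangentConeAt_of_segment_subset hseg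
  have h := hloc.hasFDerivWithinAt_nonpos hk.hasFDerivWithinAt hy
  have h' : -t₀ * k' ≤ 0 := by simpa using h
  nlinarith

end MaxPoint

/-! ### The weak maximum principle -/

/-- **Weak maximum principle for drift–diffusion SUBSOLUTIONS on the whole space** (Friedman 1964,
Ch. 2 §4 Lemma 5 — the case `a = κ I`, `c = 0`, applied to the subsolution `e^{−2εt}|v|²`). Let
`κ ≥ 0`, let `v : [0,T] × E → F` be jointly `C^∞` on the closed slab with
`⟪v, ∂ₜv⟫ ≤ ⟪v, κΔv − (u·∇)v⟫` pointwise on `[0,T] × E` (one-sided time derivative within `[0,T]`; an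
arbitrary drift `u`; e.g. `∂ₜv = κΔv − (u·∇)v + g` with `⟪v, g⟫ ≤ 0`), and let `|v(t,x)| → 0` as
`|x| → ∞` uniformly in `t ∈ [0,T]`. Then every bound `M` of `|v(0,·)|` bounds `|v|` on the slab:
`|v(t,x)| ≤ M` for all `t ∈ [0,T]`, `x ∈ E`. (No hypothesis on `u`: at a maximum point of
`e^{−2εt}|v|²` the drift term `u·∇|v|²` vanishes.) [cite: Friedman1964, Ch. 2 §4 Lemma 5] -/
theorem norm_le_of_inner_timeDeriv_le {κ T : ℝ} (hκ : 0 ≤ κ) {u : ℝ → E → E} {v : ℝ → E → F}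
    (hv : IsSmoothSpaceTimeOn (Icc 0 T) v)
    (hle : ∀ t ∈ Icc 0 T, ∀ x,
      ⟪v t x, timeDerivWithin (Icc 0 T) v t x⟫ ≤ ⟪v t x, κ • (Δ (v t)) x - convect (u t) (v t) x⟫)
    (hunif : ∀ η : ℝ, 0 < η → ∃ R : ℝ, ∀ t ∈ Icc 0 T, ∀ x : E, R ≤ ‖x‖ → ‖v t x‖ ≤ η)
    {M : ℝ} (hM : ∀ x, ‖v 0 x‖ ≤ M) : ∀ t ∈ Icc 0 T, ∀ x, ‖v t x‖ ≤ M := by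
  have hM0 : 0 ≤ M := (norm_nonneg _).trans (hM 0)
  -- the weighted bound for every `ε > 0`
  suffices key : ∀ ε : ℝ, 0 < ε →
      ∀ t ∈ Icc 0 T, ∀ x, Real.exp (-(2 * ε * t)) * ‖v t x‖ ^ 2 ≤ M ^ 2 by
    intro t ht x
    have hsq : ‖v t x‖ ^ 2 ≤ M ^ 2 := by
      have hc : Continuous fun ε : ℝ => Real.exp (-(2 * ε * t)) * ‖v t x‖ ^ 2 := by fun_prop
      have h0 : Tendsto (fun ε : ℝ => Real.exp (-(2 * ε * t)) * ‖v t x‖ ^ 2) (𝓝[>] 0)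
          (𝓝 (‖v t x‖ ^ 2)) := by
        have := (hc.tendsto 0).mono_left (nhdsWithin_le_nhds (s := Ioi (0 : ℝ)))
        simpa using this
      exact le_of_tendsto h0 (eventually_nhdsWithin_of_forall fun ε hε => key ε hε t ht x)
    exact (pow_le_pow_iff_left₀ (norm_nonneg _) hM0 two_ne_zero).mp hsq
  intro ε hε
  by_contra hcon
  push Not at hcon
  obtain ⟨t₁, ht₁, x₁, hlt⟩ := hcon
  -- `S' > M² ≥ 0` is a value of the weighted square; outside a large ball it is `< S'`, uniformly in `t`
  set S' : ℝ := Real.exp (-(2 * ε * t₁)) * ‖v t₁ x₁‖ ^ 2 with hS'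
  have hS'pos : 0 < S' := (sq_nonneg M).trans_lt hlt
  obtain ⟨R, hR⟩ := hunif (Real.sqrt S' / 2) (by positivity)
  have hexp_le : ∀ t ∈ Icc (0 : ℝ) T, Real.exp (-(2 * ε * t)) ≤ 1 := fun t ht => by
    rw [Real.exp_le_one_iff]
    nlinarith [ht.1]
  have hout : ∀ t ∈ Icc 0 T, ∀ x : E, R ≤ ‖x‖ → Real.exp (-(2 * ε * t)) * ‖v t x‖ ^ 2 < S' := by
    intro t ht x hx
    have h2 : ‖v t x‖ ^ 2 ≤ (Real.sqrt S' / 2) ^ 2 := pow_le_pow_left₀ (norm_nonneg _) (hR t ht x hx) 2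
    have h3 : (Real.sqrt S' / 2) ^ 2 = S' / 4 := by
      rw [div_pow, Real.sq_sqrt hS'pos.le]; norm_num
    calc Real.exp (-(2 * ε * t)) * ‖v t x‖ ^ 2 ≤ 1 * ‖v t x‖ ^ 2 := by
          gcongr; exact hexp_le t ht
      _ < S' := by linarith
  -- the maximum over the compact part `[0,T] × B̄_{R'}` is attained at some `(t₀, x₀)`
  set R' : ℝ := max R ‖x₁‖ with hR'
  set K : Set (ℝ × E) := Icc 0 T ×ˢ Metric.closedBall (0 : E) R' with hK
  have hKc : IsCompact K := isCompact_Icc.prod (isCompact_closedBall _ _)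
  have h1K : (t₁, x₁) ∈ K := mk_mem_prod ht₁ (by simp [hR'])
  set ψ : ℝ × E → ℝ := fun z => Real.exp (-(2 * ε * z.1)) * ‖v z.1 z.2‖ ^ 2 with hψ
  have hψc : ContinuousOn ψ K := by
    have hvc : ContinuousOn (uncurry v) K :=
      hv.continuousOn.mono (prod_mono le_rfl (subset_univ _))
    have hec : Continuous fun z : ℝ × E => Real.exp (-(2 * ε * z.1)) := by fun_prop
    exact hec.continuousOn.mul (hvc.norm.pow 2)
  obtain ⟨⟨t₀, x₀⟩, h0K, hmaxK⟩ := hKc.exists_isMaxOn ⟨(t₁, x₁), h1K⟩ hψc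
  have ht₀ : t₀ ∈ Icc 0 T := (mem_prod.mp h0K).1
  have hS'le : S' ≤ Real.exp (-(2 * ε * t₀)) * ‖v t₀ x₀‖ ^ 2 := isMaxOn_iff.mp hmaxK (t₁, x₁) h1K
  -- `(t₀, x₀)` is a maximum point over the whole slab
  have hglob : ∀ t ∈ Icc 0 T, ∀ x : E,
      Real.exp (-(2 * ε * t)) * ‖v t x‖ ^ 2 ≤ Real.exp (-(2 * ε * t₀)) * ‖v t₀ x₀‖ ^ 2 := by
    intro t ht x
    by_cases hx : ‖x‖ ≤ R'
    · exact isMaxOn_iff.mp hmaxK (t, x) (mk_mem_prod ht (by simpa using hx))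
    · have hRx : R ≤ ‖x‖ := (le_max_left _ _).trans (not_le.mp hx).le
      exact ((hout t ht x hRx).trans_le hS'le).le
  -- `t₀ > 0`, since at `t = 0` the weighted square is `≤ M² < S'`
  have ht₀pos : 0 < t₀ := by
    rcases ht₀.1.eq_or_lt with h | h
    · exfalso
      have h1 : Real.exp (-(2 * ε * t₀)) * ‖v t₀ x₀‖ ^ 2 ≤ M ^ 2 := by
        rw [← h]
        simp only [mul_zero, neg_zero, Real.exp_zero, one_mul]
        exact pow_le_pow_left₀ (norm_nonneg _) (hM x₀) 2
      linarith
    · exact h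
  -- the slice `V = v(t₀)` and its spatial maximum at `x₀`
  have hV : ContDiff ℝ ∞ (v t₀) := hv.contDiff_slice ht₀
  have hEpos : 0 < Real.exp (-(2 * ε * t₀)) := Real.exp_pos _
  have hxmax : ∀ x, ‖v t₀ x‖ ^ 2 ≤ ‖v t₀ x₀‖ ^ 2 := fun x =>
    le_of_mul_le_mul_left (hglob t₀ ht₀ x) hEpos
  have hV0pos : 0 < ‖v t₀ x₀‖ ^ 2 := by
    by_contra h
    have h' : ‖v t₀ x₀‖ ^ 2 = 0 := le_antisymm (not_lt.mp h) (sq_nonneg _)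
    rw [h', mul_zero] at hS'le
    linarith
  -- spatial conditions: `⟪V, ΔV⟫ ≤ 0`, `⟪V, (u·∇)V⟫ = ½ u·∇|V|² = 0`
  have hlap : ⟪v t₀ x₀, (Δ (v t₀)) x₀⟫ ≤ 0 := inner_laplacian_nonpos_of_forall_norm_sq_le hV hxmax
  have hconv : ⟪v t₀ x₀, convect (u t₀) (v t₀) x₀⟫ = 0 := by
    rw [convect_apply]
    exact inner_fderiv_eq_zero_of_forall_norm_sq_le hV hxmax _
  -- the (in)equation at `(t₀, x₀)` gives `⟪V, ∂ₜv⟫ ≤ κ⟪V, ΔV⟫ ≤ 0`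
  have hinner : ⟪v t₀ x₀, timeDerivWithin (Icc 0 T) v t₀ x₀⟫ ≤ 0 := by
    have h := hle t₀ ht₀ x₀
    rw [inner_sub_right, real_inner_smul_right, hconv, sub_zero] at h
    exact h.trans (mul_nonpos_iff.mpr (Or.inl ⟨hκ, hlap⟩))
  -- the time condition: `k(s) = e^{−2εs}|v(s,x₀)|²` is maximal over `[0,T]` at `t₀ > 0`
  have hγ : HasDerivWithinAt (fun s => v s x₀) (timeDerivWithin (Icc 0 T) v t₀ x₀) (Icc 0 T) t₀ := by
    rw [timeDerivWithin_apply]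
    exact (hv.differentiableWithinAt_time ht₀ x₀).hasDerivWithinAt
  have hf : HasDerivAt (fun s : ℝ => -(2 * ε * s)) (-(2 * ε)) t₀ := by
    have h := (hasDerivAt_id t₀).const_mul (2 * ε)
    simp only [id, mul_one] at h
    exact h.neg
  have hk : HasDerivWithinAt (fun s => Real.exp (-(2 * ε * s)) * ‖v s x₀‖ ^ 2)
      (Real.exp (-(2 * ε * t₀)) * (-(2 * ε)) * ‖v t₀ x₀‖ ^ 2 +
        Real.exp (-(2 * ε * t₀)) * (2 * ⟪v t₀ x₀, timeDerivWithin (Icc 0 T) v t₀ x₀⟫))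
      (Icc 0 T) t₀ :=
    hf.exp.hasDerivWithinAt.mul hγ.norm_sq
  have htime := derivWithin_Icc_nonneg_of_forall_le ht₀ ht₀pos hk (fun s hs => hglob s hs x₀)
  -- contradiction: `0 ≤ e^{−2εt₀}(−2ε|V|² + 2⟪V, ∂ₜv⟫)` with `|V(x₀)|² > 0`, `⟪V, ∂ₜv⟫ ≤ 0`
  have h1 : 0 < Real.exp (-(2 * ε * t₀)) * ε * ‖v t₀ x₀‖ ^ 2 := by positivity
  have h2 : Real.exp (-(2 * ε * t₀)) * ⟪v t₀ x₀, timeDerivWithin (Icc 0 T) v t₀ x₀⟫ ≤ 0 :=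
    mul_nonpos_iff.mpr (Or.inl ⟨hEpos.le, hinner⟩)
  nlinarith

/-- **Weak maximum principle for drift–diffusion systems on the whole space**: the equation
`∂ₜv = κΔv − (u·∇)v` (`κ ≥ 0`, arbitrary drift `u`, one-sided time derivative within `[0,T]`), `v`
jointly `C^∞` on `[0,T] × E` with `|v(t,x)| → 0` as `|x| → ∞` uniformly in `t ∈ [0,T]`:
`sup|v(t,·)| ≤ sup|v(0,·)|` in hypothesis form. [cite: Friedman1964, Ch. 2 §4 Lemma 5] -/
theorem norm_le_of_driftDiffusion {κ T : ℝ} (hκ : 0 ≤ κ) {u : ℝ → E → E} {v : ℝ → E → F}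
    (hv : IsSmoothSpaceTimeOn (Icc 0 T) v)
    (heq : ∀ t ∈ Icc 0 T, ∀ x,
      timeDerivWithin (Icc 0 T) v t x = κ • (Δ (v t)) x - convect (u t) (v t) x)
    (hunif : ∀ η : ℝ, 0 < η → ∃ R : ℝ, ∀ t ∈ Icc 0 T, ∀ x : E, R ≤ ‖x‖ → ‖v t x‖ ≤ η)
    {M : ℝ} (hM : ∀ x, ‖v 0 x‖ ≤ M) : ∀ t ∈ Icc 0 T, ∀ x, ‖v t x‖ ≤ M :=
  norm_le_of_inner_timeDeriv_le hκ hv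
    (fun t ht x => (congrArg (fun w : F => ⟪v t x, w⟫) (heq t ht x)).le) hunif hM

/-- The same principle for the equation written as `∂ₜv − κΔv + (u·∇)v = 0` (the shape of, e.g.,
`Literature.Claims.NS.Liu2025.IsDriftHeatSolutionOn.eqn`). [cite: Friedman1964, Ch. 2 §4 Lemma 5] -/
theorem norm_le_of_driftDiffusion' {κ T : ℝ} (hκ : 0 ≤ κ) {u : ℝ → E → E} {v : ℝ → E → F}
    (hv : IsSmoothSpaceTimeOn (Icc 0 T) v)
    (heq : ∀ t ∈ Icc 0 T, ∀ x,
      timeDerivWithin (Icc 0 T) v t x - κ • (Δ (v t)) x + convect (u t) (v t) x = 0)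
    (hunif : ∀ η : ℝ, 0 < η → ∃ R : ℝ, ∀ t ∈ Icc 0 T, ∀ x : E, R ≤ ‖x‖ → ‖v t x‖ ≤ η)
    {M : ℝ} (hM : ∀ x, ‖v 0 x‖ ≤ M) : ∀ t ∈ Icc 0 T, ∀ x, ‖v t x‖ ≤ M :=
  norm_le_of_driftDiffusion hκ hv (fun t ht x => by
    have := heq t ht x
    rw [← sub_eq_zero, ← this]
    abel) hunif hM

end Literature.Analysis.FluidPDE

end
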